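import Mathlib
import HarnessLib
import Literature.Analysis.FluidPDE.TypeIAncientMild
import Literature.Analysis.FluidPDE.LocalTypeIReverseTools

/-!
# `AxisymEndLiouvilleOfFarPastLedger` (stmt-NavierStokesRegularity-14736), 𝒦-route helper:
# the cubic quantity of a Type-I ancient mild field under the far-past ledger

For a Type-I ancient mild field `u ∈ A_C` (`IsTypeIAncientMild C u`: jointly smooth on `t < 0`,
`‖u(t,x)‖ ≤ C/√(−t)`) obeying the far-past energy LEDGER with constant `K`
(`∫_{B_R(x₀)} ‖u(t)‖² ≤ K R` for all `t < 0`, all centres, all radii — the conclusion of the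
route's crux `FarPastLedger` for this field), the Caffarelli–Kohn–Nirenberg / Albritton–Barker
cubic quantity is bounded at EVERY scale and every centre with `t ≤ 0`:

* `setIntegral_norm_pow_three_le` — one slice: `∫_{B_R(x₀)} ‖u(t)‖³ ≤ (C/√(−t)) · K R`
  (`‖u‖³ ≤ ‖u‖_∞ ‖u‖²`);
* `lintegral_parabolicCylinder_le` — `∫_{Q(z,R)} ‖u‖³ ≤ 2 C K R²` for `z.1 ≤ 0`
  (`∫_{t-R²}^{t} (−τ)^{-1/2} dτ ≤ 2R`);
* `cknC_le_of_ledger` — `C(Q(z,R)) = R⁻² ∫_{Q(z,R)} ‖u‖³ ≤ 2 C K`, uniformly in `R > 0`.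

This is the velocity half of "`A_C ⊂ 𝒦` given the ledger" (item text: "C(Q_r) ≤ 2CK from
|v|³ ≤ ‖v‖∞|v|²"), the uniform `L³` bound feeding Albritton–Barker's compactness lemma along the
blow-down sequence.
-/

noncomputable section

-- the summit and its single problem share the name (D-0017 nested layout)
set_option linter.dupNamespace false

open MeasureTheory Set Metric Filter Function
open scoped ENNReal NNReal Topology

namespace Summit.NavierStokesRegularity.NavierStokesRegularity.Theorems.AxisymEndLiouvilleOfFarPastLedger

open Literature.Analysis.FluidPDE

/-- **One slice of the cubic bound.** For `u ∈ A_C` with the ledger constant `K`, `t < 0`,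
`∫_{B_R(x₀)} ‖u(t)‖³ ≤ (C/√(−t)) · (K R)`: pointwise `‖u‖³ = ‖u‖ ‖u‖² ≤ (C/√(−t)) ‖u‖²`, then the
ledger. [folklore] -/
theorem setIntegral_norm_pow_three_le {C K : ℝ} {u : ℝ → (EuclideanSpace ℝ (Fin 3)) → (EuclideanSpace ℝ (Fin 3))} (hu : IsTypeIAncientMild C u)
    (hK : ∀ t < 0, ∀ (x₀ : (EuclideanSpace ℝ (Fin 3))) (R : ℝ), 0 < R → ∫ x in ball x₀ R, ‖u t x‖ ^ 2 ≤ K * R)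
    {t : ℝ} (ht : t < 0) (x₀ : (EuclideanSpace ℝ (Fin 3))) {R : ℝ} (hR : 0 < R) :
    ∫ x in ball x₀ R, ‖u t x‖ ^ 3 ≤ C / Real.sqrt (-t) * (K * R) := by
  have hM : 0 ≤ C / Real.sqrt (-t) := div_nonneg hu.nonneg (Real.sqrt_nonneg _)
  have hcont : Continuous (u t) := hu.continuous_slice ht
  have hint2 : IntegrableOn (fun x => ‖u t x‖ ^ 2) (ball x₀ R) volume :=
    ((hcont.norm.pow 2).continuousOn.integrableOn_compact (isCompact_closedBall x₀ R)).mono_set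
      ball_subset_closedBall
  have hint3 : IntegrableOn (fun x => ‖u t x‖ ^ 3) (ball x₀ R) volume :=
    ((hcont.norm.pow 3).continuousOn.integrableOn_compact (isCompact_closedBall x₀ R)).mono_set
      ball_subset_closedBall
  have hpt : ∀ x, ‖u t x‖ ^ 3 ≤ C / Real.sqrt (-t) * ‖u t x‖ ^ 2 := fun x => by
    have h1 : ‖u t x‖ ≤ C / Real.sqrt (-t) := hu.norm_le ht x
    have h2 : 0 ≤ ‖u t x‖ ^ 2 := sq_nonneg _
    calc ‖u t x‖ ^ 3 = ‖u t x‖ * ‖u t x‖ ^ 2 := by ring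
      _ ≤ C / Real.sqrt (-t) * ‖u t x‖ ^ 2 := mul_le_mul_of_nonneg_right h1 h2
  calc ∫ x in ball x₀ R, ‖u t x‖ ^ 3
      ≤ ∫ x in ball x₀ R, C / Real.sqrt (-t) * ‖u t x‖ ^ 2 :=
        setIntegral_mono_on hint3 (hint2.const_mul _) measurableSet_ball fun x _ => hpt x
    _ = C / Real.sqrt (-t) * ∫ x in ball x₀ R, ‖u t x‖ ^ 2 := integral_const_mul _ _
    _ ≤ C / Real.sqrt (-t) * (K * R) := mul_le_mul_of_nonneg_left (hK t ht x₀ R hR) hM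

/-- The same slice bound in `ℝ≥0∞` form: `∫⁻_{B_R(x₀)} ‖u(t)‖ₑ³ ≤ ofReal ((C/√(−t)) K R)`. [folklore] -/
theorem setLIntegral_enorm_pow_three_le {C K : ℝ} {u : ℝ → (EuclideanSpace ℝ (Fin 3)) → (EuclideanSpace ℝ (Fin 3))} (hu : IsTypeIAncientMild C u)
    (hK : ∀ t < 0, ∀ (x₀ : (EuclideanSpace ℝ (Fin 3))) (R : ℝ), 0 < R → ∫ x in ball x₀ R, ‖u t x‖ ^ 2 ≤ K * R)
    {t : ℝ} (ht : t < 0) (x₀ : (EuclideanSpace ℝ (Fin 3))) {R : ℝ} (hR : 0 < R) :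
    ∫⁻ x in ball x₀ R, ‖u t x‖ₑ ^ (3 : ℕ) ≤ ENNReal.ofReal (C / Real.sqrt (-t) * (K * R)) := by
  have hcont : Continuous (u t) := hu.continuous_slice ht
  have hint3 : IntegrableOn (fun x => ‖u t x‖ ^ 3) (ball x₀ R) volume :=
    ((hcont.norm.pow 3).continuousOn.integrableOn_compact (isCompact_closedBall x₀ R)).mono_set
      ball_subset_closedBall
  have e : ∫⁻ x in ball x₀ R, ‖u t x‖ₑ ^ (3 : ℕ) =
      ENNReal.ofReal (∫ x in ball x₀ R, ‖u t x‖ ^ 3) := by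
    rw [ofReal_integral_eq_lintegral_ofReal hint3 (ae_of_all _ fun x => by positivity)]
    refine lintegral_congr fun x => ?_
    rw [← ofReal_norm, ENNReal.ofReal_pow (norm_nonneg _)]
  rw [e]
  exact ENNReal.ofReal_le_ofReal (setIntegral_norm_pow_three_le hu hK ht x₀ hR)

/-- `∫_{a}^{b} (−τ)^{-1/2} dτ ≤ 2 √(b − a)` for `a ≤ b ≤ 0`: the integral is
`2(√(−a) − √(−b))` and `√(−a) ≤ √(−b) + √(b − a)`. [folklore] -/
theorem integral_inv_sqrt_neg_le {a b : ℝ} (hab : a ≤ b) (hb : b ≤ 0) :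
    ∫ τ in a..b, (Real.sqrt (-τ))⁻¹ ≤ 2 * Real.sqrt (b - a) := by
  -- substitute `σ = -τ` and use `∫ σ^{-1/2} = 2 σ^{1/2}`
  have hr : (-1 : ℝ) < -(1 / 2) := by norm_num
  have e1 : ∫ τ in a..b, (Real.sqrt (-τ))⁻¹ = ∫ σ in (-b)..(-a), (Real.sqrt σ)⁻¹ := by
    rw [intervalIntegral.integral_comp_neg fun σ => (Real.sqrt σ)⁻¹]
  have e2 : ∫ σ in (-b)..(-a), (Real.sqrt σ)⁻¹ = ∫ σ in (-b)..(-a), σ ^ (-(1 / 2) : ℝ) := by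
    refine intervalIntegral.integral_congr fun σ hσ => ?_
    have hσ0 : 0 ≤ σ := by
      rw [uIcc_of_le (by linarith)] at hσ
      linarith [hσ.1]
    rw [Real.sqrt_eq_rpow, Real.rpow_neg hσ0]
  have e3 : ∫ σ in (-b)..(-a), σ ^ (-(1 / 2) : ℝ) =
      ((-a) ^ (-(1 / 2) + 1 : ℝ) - (-b) ^ (-(1 / 2) + 1 : ℝ)) / (-(1 / 2) + 1) :=
    integral_rpow (Or.inl hr)
  rw [e1, e2, e3]
  have h12 : (-(1 / 2) + 1 : ℝ) = 1 / 2 := by norm_num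
  rw [h12]
  have hsa : (-a) ^ (1 / 2 : ℝ) = Real.sqrt (-a) := (Real.sqrt_eq_rpow (-a)).symm
  have hsb : (-b) ^ (1 / 2 : ℝ) = Real.sqrt (-b) := (Real.sqrt_eq_rpow (-b)).symm
  rw [hsa, hsb]
  -- `√(-a) ≤ √(-b) + √(b - a)`
  have hsub : Real.sqrt (-a) ≤ Real.sqrt (-b) + Real.sqrt (b - a) := by
    have hba : 0 ≤ b - a := sub_nonneg.2 hab
    have hb' : 0 ≤ -b := neg_nonneg.2 hb
    have hprod : 0 ≤ Real.sqrt (-b) * Real.sqrt (b - a) :=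
      mul_nonneg (Real.sqrt_nonneg _) (Real.sqrt_nonneg _)
    calc Real.sqrt (-a) ≤ Real.sqrt ((Real.sqrt (-b) + Real.sqrt (b - a)) ^ 2) :=
          Real.sqrt_le_sqrt (by nlinarith [Real.sq_sqrt hb', Real.sq_sqrt hba])
      _ = Real.sqrt (-b) + Real.sqrt (b - a) := Real.sqrt_sq (by positivity)
  have : (Real.sqrt (-a) - Real.sqrt (-b)) / (1 / 2) = 2 * (Real.sqrt (-a) - Real.sqrt (-b)) := by
    ring
  rw [this]
  linarith

/-- **The cubic bound on a parabolic ball.** For `u ∈ A_C` with ledger constant `K`, every centre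
`z = (t, x)` with `t ≤ 0` and every radius `R > 0`:
`∫_{Q(z,R)} ‖u‖³ ≤ 2 C K R²` (Tonelli, the slice bound, `∫_{t-R²}^{t} (−τ)^{-1/2} dτ ≤ 2R`).
[folklore] -/
theorem lintegral_parabolicCylinder_le {C K : ℝ} {u : ℝ → (EuclideanSpace ℝ (Fin 3)) → (EuclideanSpace ℝ (Fin 3))} (hu : IsTypeIAncientMild C u)
    (hK : ∀ t < 0, ∀ (x₀ : (EuclideanSpace ℝ (Fin 3))) (R : ℝ), 0 < R → ∫ x in ball x₀ R, ‖u t x‖ ^ 2 ≤ K * R)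
    {z : ℝ × (EuclideanSpace ℝ (Fin 3))} (hz : z.1 ≤ 0) {R : ℝ} (hR : 0 < R) :
    ∫⁻ q in parabolicCylinder R z, ‖u q.1 q.2‖ₑ ^ (3 : ℕ) ≤
      ENNReal.ofReal (2 * C * K * R ^ 2) := by
  have hC : 0 ≤ C := hu.nonneg
  have hK0 : 0 ≤ K := by
    -- the ledger at `t = -1`, `R = 1` bounds a nonnegative integral
    have h := hK (-1) (by norm_num) 0 1 one_pos
    have h0 : 0 ≤ ∫ x in ball (0 : (EuclideanSpace ℝ (Fin 3))) 1, ‖u (-1) x‖ ^ 2 := integral_nonneg fun x => sq_nonneg _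
    linarith
  set I : Set ℝ := Ioo (z.1 - R ^ 2) z.1 with hI
  set B : Set (EuclideanSpace ℝ (Fin 3)) := ball z.2 R with hB
  -- Tonelli (inequality form, no measurability needed)
  have hprod : ∫⁻ q in parabolicCylinder R z, ‖u q.1 q.2‖ₑ ^ (3 : ℕ) ≤
      ∫⁻ τ in I, ∫⁻ x in B, ‖u τ x‖ₑ ^ (3 : ℕ) := by
    have e : (volume : Measure (ℝ × (EuclideanSpace ℝ (Fin 3)))).restrict (parabolicCylinder R z) =
        ((volume : Measure ℝ).restrict I).prod ((volume : Measure (EuclideanSpace ℝ (Fin 3))).restrict B) := by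
      rw [show parabolicCylinder R z = I ×ˢ B from rfl, Measure.volume_eq_prod,
        Measure.prod_restrict]
    rw [e]
    exact lintegral_prod_le _
  refine hprod.trans ?_
  -- the slice bound, for `τ ∈ I ⊆ (-∞, 0)`
  have hslice : ∀ τ ∈ I, ∫⁻ x in B, ‖u τ x‖ₑ ^ (3 : ℕ) ≤
      ENNReal.ofReal (C * K * R * (Real.sqrt (-τ))⁻¹) := by
    intro τ hτ
    have hτ0 : τ < 0 := lt_of_lt_of_le hτ.2 hz
    refine (setLIntegral_enorm_pow_three_le hu hK hτ0 z.2 hR).trans (le_of_eq ?_)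
    congr 1
    rw [div_eq_mul_inv]
    ring
  have hmono : ∫⁻ τ in I, ∫⁻ x in B, ‖u τ x‖ₑ ^ (3 : ℕ) ≤
      ∫⁻ τ in I, ENNReal.ofReal (C * K * R * (Real.sqrt (-τ))⁻¹) :=
    setLIntegral_mono' measurableSet_Ioo fun τ hτ => hslice τ hτ
  refine hmono.trans ?_
  -- integrate the majorant in time
  have hab : z.1 - R ^ 2 ≤ z.1 := by nlinarith
  have hii : IntervalIntegrable (fun τ : ℝ => (Real.sqrt (-τ))⁻¹) volume (z.1 - R ^ 2) z.1 := by
    -- `(√(-τ))⁻¹ = (-τ)^{-1/2}` up to the reflection `τ ↦ -τ`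
    have h1 : IntervalIntegrable (fun σ : ℝ => σ ^ (-(1 / 2) : ℝ)) volume (-(z.1 - R ^ 2)) (-z.1) :=
      intervalIntegral.intervalIntegrable_rpow' (by norm_num)
    have h3 : IntervalIntegrable (fun τ : ℝ => (-τ) ^ (-(1 / 2) : ℝ)) volume (z.1 - R ^ 2) z.1 := by
      have h2 := (IntervalIntegrable.iff_comp_neg (f := fun σ : ℝ => σ ^ (-(1 / 2) : ℝ))
        (a := -(z.1 - R ^ 2)) (b := -z.1)).mp h1
      simpa only [neg_neg] using h2
    refine h3.congr fun τ hτ => ?_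
    have hτ0 : 0 ≤ -τ := by
      rw [uIoc_of_le hab] at hτ
      linarith [hτ.2]
    rw [Real.sqrt_eq_rpow, Real.rpow_neg hτ0]
  have hnn : 0 ≤ᵐ[volume.restrict (Ioc (z.1 - R ^ 2) z.1)] fun τ => (Real.sqrt (-τ))⁻¹ :=
    ae_of_all _ fun τ => inv_nonneg.2 (Real.sqrt_nonneg _)
  have hint : IntegrableOn (fun τ : ℝ => (Real.sqrt (-τ))⁻¹) (Ioc (z.1 - R ^ 2) z.1) volume :=
    (intervalIntegrable_iff_integrableOn_Ioc_of_le hab).1 hii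
  have hintI : IntegrableOn (fun τ : ℝ => (Real.sqrt (-τ))⁻¹) I volume :=
    hint.mono_set Ioo_subset_Ioc_self
  calc ∫⁻ τ in I, ENNReal.ofReal (C * K * R * (Real.sqrt (-τ))⁻¹)
      = ∫⁻ τ in I, ENNReal.ofReal (C * K * R) * ENNReal.ofReal ((Real.sqrt (-τ))⁻¹) := by
        refine lintegral_congr fun τ => ?_
        rw [← ENNReal.ofReal_mul (by positivity)]
    _ = ENNReal.ofReal (C * K * R) * ∫⁻ τ in I, ENNReal.ofReal ((Real.sqrt (-τ))⁻¹) := by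
        rw [lintegral_const_mul' _ _ ENNReal.ofReal_ne_top]
    _ = ENNReal.ofReal (C * K * R) * ENNReal.ofReal (∫ τ in I, (Real.sqrt (-τ))⁻¹) := by
        rw [ofReal_integral_eq_lintegral_ofReal hintI
          (ae_of_all _ fun τ => inv_nonneg.2 (Real.sqrt_nonneg _))]
    _ ≤ ENNReal.ofReal (C * K * R) * ENNReal.ofReal (2 * R) := by
        gcongr
        calc ∫ τ in I, (Real.sqrt (-τ))⁻¹
            = ∫ τ in Ioc (z.1 - R ^ 2) z.1, (Real.sqrt (-τ))⁻¹ :=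
              (setIntegral_congr_set Ioo_ae_eq_Ioc)
          _ = ∫ τ in (z.1 - R ^ 2)..z.1, (Real.sqrt (-τ))⁻¹ :=
              (intervalIntegral.integral_of_le hab).symm
          _ ≤ 2 * Real.sqrt (z.1 - (z.1 - R ^ 2)) := integral_inv_sqrt_neg_le hab hz
          _ = 2 * R := by
              rw [show z.1 - (z.1 - R ^ 2) = R ^ 2 by ring, Real.sqrt_sq hR.le]
    _ = ENNReal.ofReal (2 * C * K * R ^ 2) := by
        rw [← ENNReal.ofReal_mul (by positivity)]
        congr 1
        ring

/-- **Albritton–Barker's cubic quantity is bounded at every scale under the ledger**: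
`C(Q(z,R)) = R⁻² ∫_{Q(z,R)} ‖u‖³ ≤ 2 C K` for every `u ∈ A_C` with ledger constant `K`, every centre
with `t ≤ 0` and every `R > 0` — the uniform `L³` bound of the blow-down sequence
(item text: "C(Q_r) ≤ 2CK from |v|³ ≤ ‖v‖∞|v|²"). [folklore] -/
theorem cknC_le_of_ledger {C K : ℝ} {u : ℝ → (EuclideanSpace ℝ (Fin 3)) → (EuclideanSpace ℝ (Fin 3))} (hu : IsTypeIAncientMild C u)
    (hK : ∀ t < 0, ∀ (x₀ : (EuclideanSpace ℝ (Fin 3))) (R : ℝ), 0 < R → ∫ x in ball x₀ R, ‖u t x‖ ^ 2 ≤ K * R)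
    {z : ℝ × (EuclideanSpace ℝ (Fin 3))} (hz : z.1 ≤ 0) {R : ℝ} (hR : 0 < R) :
    cknC R z u ≤ ENNReal.ofReal (2 * C * K) := by
  have hC : 0 ≤ C := hu.nonneg
  have hK0 : 0 ≤ K := by
    have h := hK (-1) (by norm_num) 0 1 one_pos
    have h0 : 0 ≤ ∫ x in ball (0 : (EuclideanSpace ℝ (Fin 3))) 1, ‖u (-1) x‖ ^ 2 := integral_nonneg fun x => sq_nonneg _
    linarith
  unfold cknC
  have hR2 : ENNReal.ofReal R ^ 2 ≠ 0 := pow_ne_zero _ (ENNReal.ofReal_pos.2 hR).ne'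
  have hR2' : ENNReal.ofReal R ^ 2 ≠ ∞ := ENNReal.pow_ne_top ENNReal.ofReal_ne_top
  rw [ENNReal.inv_mul_le_iff hR2 hR2', ← ENNReal.ofReal_pow hR.le,
    ← ENNReal.ofReal_mul (by positivity)]
  refine (lintegral_parabolicCylinder_le hu hK hz hR).trans (le_of_eq ?_)
  congr 1
  ring

end Summit.NavierStokesRegularity.NavierStokesRegularity.Theorems.AxisymEndLiouvilleOfFarPastLedger

end
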